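import Summits.ResolutionOfSingularities.ResolutionOfSingularities.Theorems.PurelyInseparableDim4PureLeafUnitEven
import Summits.ResolutionOfSingularities.ResolutionOfSingularities.Theorems.PurelyInseparableDim4PureLeafOneOdd
import HarnessLib
import HarnessLib.Audit.Tags

/-!
# Purely inseparable fourfolds — UNIT LEAVES WITH `a₀ = 1`: product bookkeeping and the cleaned term shapes of the `Q`-orbit (prep)
# (cell res-dim4-pi; brick (δ) «unit leaves x^a(1+x_j)», UNIFORM family «a₀ = 1, one odd partner, even rest») [OURS · counted 0 · a theorem about OUR coordinate-centre frame v4, not about resolution]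

Width seat `res-dim4-p-10` (g5).  CONTEXT.  For the unit leaves `x^a(1+x₀)` over `𝔽₂` with `a₀` odd and another odd exponent,
B's located defence (memo `pub/res-dim4/res-dim4-p-10/UNIT-CLASS-TEXT.md` §2) is the RESERVOIR: while A grinds an even power
`x_i^{a_i}`, B's replies may translate the idle variables (`x_m^{c} ↔ (1+x_m)^{c}`, «dress»), and dress is later cashed into the
mixed unit `1 + x₀x₁`.  This file and its two sequels prove that for `a₀ = 1` the reservoir CANNOT be cashed: after A's forced
pair `{x₀, x₁}` the chart-`x₁` replies present `S²·(x₀ + x₀²x₁)` («`Q`») or its translate `S²·(x₀ + x₁ + x₀²x₁)` («`R`»), `S²`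
the even dress on `x₂, x₃`; A then grinds the dress, B's translations only permute `Q ↔ R`, and when the `x`-part of the dress is
exhausted the state has order `1`.  THIS FILE (prep): product bookkeeping (`X_mul_prod'`, `one_add_X_mul_prod`, the splits
`prod_update_e_succ` (I1) `N(a,e+δ_j) = N(a,e) + N(a+δ_j,e)` and `prod_update_e_add_two` (I2) `(1+x_j)² = 1 + x_j²`; p-10 g2's
`X_eq_prod` cited), the cleaning of product terms (`deletePthPowers_prod_of_purelyOdd` / `_of_forall_even`, from p-10 g2's (α)/(β)
lemmas), and the cleaned term shapes of the `Q`-orbit (`clean_flip0`, `clean_flip1`, `clean_flip1_sq0`, `clean_flip1_dsq0`,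
`split_dsq0`).  Normal form throughout: `N(a,e) = ∏ x_l^{a_l}(1+x_l)^{e_l}` with explicit exponent vectors `![·,·,·,·]`; unit
variable `x₀`, partner `x₁`, dress parameters `p q r s` / `g₂ g₃ e₂ e₃` (even).

Riders: `𝔽₂`-rational replies (the game over `ZMod 2`); the PLAIN coordinate game of OUR frame v4 (`StateWins 2`), not MODE 1h
and not CJS's algorithm; nothing here proves F4-C(2,2), `Terminates1h 2 2` or resolution of singularities in dimension ≥ 4 /
characteristic `p`; counted 0; AI kernel work, weaker than expert review. bears_on: LADDER-RESOLUTION:D157-DOOR2 (res-dim4-pi ·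
brick (δ) · unit-leaf row, uniform theorem). Supports stmt-ResolutionOfSingularities-16155 (helper).
-/

set_option linter.dupNamespace false

open MvPolynomial Finset

open scoped BigOperators

noncomputable section

namespace Summit.ResolutionOfSingularities.ResolutionOfSingularities.Theorems.PIDim4

namespace PureLeafNF

open Literature.AlgebraicGeometry.Resolution
open Literature.AlgebraicGeometry.Resolution.Hauser2010
open CentreBlowup PthPowerFactor

/-! ## 1. Product bookkeeping -/

/-- `x_j · N(a,e) = N(a + δ_j, e)`. [folklore] -/
theorem X_mul_prod' (a e : Fin 4 → ℕ) (j : Fin 4) :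
    (X j : MvPolynomial (Fin 4) (ZMod 2)) * ∏ i, X i ^ a i * (1 + X i) ^ e i =
      ∏ i, X i ^ Function.update a j (a j + 1) i * (1 + X i) ^ e i := by
  rw [X_eq_prod j, prod_mul_prod]
  refine Finset.prod_congr rfl fun i _ => ?_
  by_cases hij : i = j
  · subst hij; rw [if_pos rfl, Function.update_self, zero_add, Nat.add_comm]
  · rw [if_neg hij, Function.update_of_ne hij, zero_add, zero_add]

/-- `(1 + x_j) = N(0, δ_j)`. [folklore] -/
theorem one_add_X_eq_prod (j : Fin 4) :
    (1 + X j : MvPolynomial (Fin 4) (ZMod 2)) = ∏ i, X i ^ (0 : ℕ) * (1 + X i) ^ (if i = j then 1 else 0) := by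
  rw [← Finset.mul_prod_erase Finset.univ _ (Finset.mem_univ j), if_pos rfl, pow_one, pow_zero, one_mul,
    Finset.prod_eq_one fun i hi => ?_, mul_one]
  rw [if_neg (Finset.ne_of_mem_erase hi), pow_zero, pow_zero, mul_one]

/-- `(1 + x_j) · N(a,e) = N(a, e + δ_j)`. [folklore] -/
theorem one_add_X_mul_prod (a e : Fin 4 → ℕ) (j : Fin 4) :
    (1 + X j : MvPolynomial (Fin 4) (ZMod 2)) * ∏ i, X i ^ a i * (1 + X i) ^ e i =
      ∏ i, X i ^ a i * (1 + X i) ^ Function.update e j (e j + 1) i := by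
  rw [one_add_X_eq_prod j, prod_mul_prod]
  refine Finset.prod_congr rfl fun i _ => ?_
  by_cases hij : i = j
  · subst hij; rw [if_pos rfl, Function.update_self, zero_add, Nat.add_comm]
  · rw [if_neg hij, Function.update_of_ne hij, zero_add, zero_add]

/-- **(I1)** `N(a, e + δ_j) = N(a, e) + N(a + δ_j, e)` — the dressed factor split `(1+x_j) = 1 + x_j`. [folklore] -/
theorem prod_update_e_succ (a e : Fin 4 → ℕ) (j : Fin 4) :
    (∏ i, X i ^ a i * (1 + X i) ^ Function.update e j (e j + 1) i : MvPolynomial (Fin 4) (ZMod 2)) =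
      (∏ i, X i ^ a i * (1 + X i) ^ e i) + ∏ i, X i ^ Function.update a j (a j + 1) i * (1 + X i) ^ e i := by
  rw [← one_add_X_mul_prod, ← X_mul_prod', add_mul, one_mul]

/-- In characteristic `2`: `(1 + x_j)² = 1 + x_j²`. [folklore] -/
theorem one_add_X_sq_eq (j : Fin 4) : ((1 + X j) ^ 2 : MvPolynomial (Fin 4) (ZMod 2)) = 1 + X j ^ 2 := by
  rw [one_add_X_sq, map_add, map_one, expand_X]

/-- **(I2)** `N(a, e + 2δ_j) = N(a, e) + N(a + 2δ_j, e)` — `(1+x_j)² = 1 + x_j²` over `𝔽₂`. [folklore] -/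
theorem prod_update_e_add_two (a e : Fin 4 → ℕ) (j : Fin 4) :
    (∏ i, X i ^ a i * (1 + X i) ^ Function.update e j (e j + 2) i : MvPolynomial (Fin 4) (ZMod 2)) =
      (∏ i, X i ^ a i * (1 + X i) ^ e i) + ∏ i, X i ^ Function.update a j (a j + 2) i * (1 + X i) ^ e i := by
  have h1 : (∏ i, X i ^ a i * (1 + X i) ^ Function.update e j (e j + 2) i : MvPolynomial (Fin 4) (ZMod 2)) =
      (1 + X j) ^ 2 * ∏ i, X i ^ a i * (1 + X i) ^ e i := by
    rw [pow_two, mul_assoc, one_add_X_mul_prod, one_add_X_mul_prod, Function.update_idem, Function.update_self]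
  have h2 : (∏ i, X i ^ Function.update a j (a j + 2) i * (1 + X i) ^ e i : MvPolynomial (Fin 4) (ZMod 2)) =
      X j ^ 2 * ∏ i, X i ^ a i * (1 + X i) ^ e i := by
    rw [pow_two, mul_assoc, X_mul_prod', X_mul_prod', Function.update_idem, Function.update_self]
  rw [h1, h2, one_add_X_sq_eq, add_mul, one_mul]

/-- In characteristic `2` a polynomial added to itself vanishes. [folklore] -/
theorem add_self_eq_zero' (P : MvPolynomial (Fin 4) (ZMod 2)) : P + P = 0 :=
  CharTwo.add_self_eq_zero P


/-! ## 2. Cleaning of product terms -/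

/-- A product with a purely odd factor has no square monomial: the cleaning keeps it. [folklore] -/
theorem deletePthPowers_prod_of_purelyOdd (a e : Fin 4 → ℕ) {l : Fin 4} (ha : a l % 2 = 1) (he : e l % 2 = 0) :
    deletePthPowers 2 (∏ i, X i ^ a i * (1 + X i) ^ e i : MvPolynomial (Fin 4) (ZMod 2)) =
      ∏ i, X i ^ a i * (1 + X i) ^ e i := by
  have h := sub_deletePthPowers_of_purelyOdd a e (k := l) ha he
  exact (sub_eq_zero.mp h).symm

/-- An all-even product is a square: the cleaning deletes it. [folklore] -/
theorem deletePthPowers_prod_of_forall_even (a e : Fin 4 → ℕ) (ha : ∀ l, a l % 2 = 0) (he : ∀ l, e l % 2 = 0) :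
    deletePthPowers 2 (∏ i, X i ^ a i * (1 + X i) ^ e i : MvPolynomial (Fin 4) (ZMod 2)) = 0 := by
  have h := sub_deletePthPowers_of_forall_even a e ha
  have hê : (∏ i, X i ^ a i * (1 + X i) ^ (e i - e i % 2) : MvPolynomial (Fin 4) (ZMod 2)) =
      ∏ i, X i ^ a i * (1 + X i) ^ e i :=
    Finset.prod_congr rfl fun i _ => by rw [show e i - e i % 2 = e i by have := he i; omega]
  rw [hê] at h
  exact sub_eq_self.mp h

/-- The singleton transform of a product term (chart `x_i`, reply `b`): chart-and-swap. [folklore] -/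
theorem translate_chartTransform_singleton_prod (a e : Fin 4 → ℕ) {i : Fin 4} (hi : 2 ≤ a i) (b : Fin 4 → ZMod 2) :
    PointBlowup.translate b (chartTransform 2 {i} i (∏ l, X l ^ a l * (1 + X l) ^ e l : MvPolynomial (Fin 4) (ZMod 2))) =
      ∏ l, X l ^ (if b l = 0 then Function.update a i (a i - 2) l else e l) *
        (1 + X l) ^ (if b l = 0 then e l else Function.update a i (a i - 2) l) := by
  rw [chartTransform_singleton_prod a e hi, translate_prod_zmod2]

/-! ## 3. Term identities for the `Q`-orbit (unit variable `x₀`, partner `x₁`, even dress on `x₂, x₃`)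

The six product shapes that occur as translated terms, and their cleaned forms.  Parameters `p q` (the `x`-exponents of the
dress at `x₂, x₃`) and `r s` (its `(1+x)`-exponents), all even. -/

/-- `(1+x₀)·S²` cleans to `x₀·S²`. [folklore] -/
theorem clean_flip0 (p q r s : ℕ) (hp : p % 2 = 0) (hq : q % 2 = 0) (hr : r % 2 = 0) (hs : s % 2 = 0) :
    deletePthPowers 2 (∏ l, X l ^ (![0, 0, p, q] : Fin 4 → ℕ) l * (1 + X l) ^ (![1, 0, r, s] : Fin 4 → ℕ) l : MvPolynomial (Fin 4) (ZMod 2)) = (∏ l, X l ^ (![1, 0, p, q] : Fin 4 → ℕ) l * (1 + X l) ^ (![0, 0, r, s] : Fin 4 → ℕ) l : MvPolynomial (Fin 4) (ZMod 2)) := by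
  have hI := prod_update_e_succ (![0, 0, p, q] : Fin 4 → ℕ) (![0, 0, r, s] : Fin 4 → ℕ) 0
  have h1 : (Function.update (![0, 0, r, s] : Fin 4 → ℕ) 0 ((![0, 0, r, s] : Fin 4 → ℕ) 0 + 1)) = ![1, 0, r, s] := by
    funext l; fin_cases l <;> simp
  have h2 : (Function.update (![0, 0, p, q] : Fin 4 → ℕ) 0 ((![0, 0, p, q] : Fin 4 → ℕ) 0 + 1)) = ![1, 0, p, q] := by
    funext l; fin_cases l <;> simp
  rw [h1, h2] at hI
  rw [hI, deletePthPowers_add, deletePthPowers_prod_of_forall_even _ _ (by intro l; fin_cases l <;> simp <;> omega)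
    (by intro l; fin_cases l <;> simp <;> omega), zero_add,
    deletePthPowers_prod_of_purelyOdd _ _ (l := 0) (by simp) (by simp)]

/-- `(1+x₁)·S²` cleans to `x₁·S²`. [folklore] -/
theorem clean_flip1 (p q r s : ℕ) (hp : p % 2 = 0) (hq : q % 2 = 0) (hr : r % 2 = 0) (hs : s % 2 = 0) :
    deletePthPowers 2 (∏ l, X l ^ (![0, 0, p, q] : Fin 4 → ℕ) l * (1 + X l) ^ (![0, 1, r, s] : Fin 4 → ℕ) l : MvPolynomial (Fin 4) (ZMod 2)) = (∏ l, X l ^ (![0, 1, p, q] : Fin 4 → ℕ) l * (1 + X l) ^ (![0, 0, r, s] : Fin 4 → ℕ) l : MvPolynomial (Fin 4) (ZMod 2)) := by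
  have hI := prod_update_e_succ (![0, 0, p, q] : Fin 4 → ℕ) (![0, 0, r, s] : Fin 4 → ℕ) 1
  have h1 : (Function.update (![0, 0, r, s] : Fin 4 → ℕ) 1 ((![0, 0, r, s] : Fin 4 → ℕ) 1 + 1)) = ![0, 1, r, s] := by
    funext l; fin_cases l <;> simp
  have h2 : (Function.update (![0, 0, p, q] : Fin 4 → ℕ) 1 ((![0, 0, p, q] : Fin 4 → ℕ) 1 + 1)) = ![0, 1, p, q] := by
    funext l; fin_cases l <;> simp
  rw [h1, h2] at hI
  rw [hI, deletePthPowers_add, deletePthPowers_prod_of_forall_even _ _ (by intro l; fin_cases l <;> simp <;> omega)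
    (by intro l; fin_cases l <;> simp <;> omega), zero_add,
    deletePthPowers_prod_of_purelyOdd _ _ (l := 1) (by simp) (by simp)]

/-- `x₀²(1+x₁)·S²` cleans to `x₀²x₁·S²`. [folklore] -/
theorem clean_flip1_sq0 (p q r s : ℕ) (hp : p % 2 = 0) (hq : q % 2 = 0) (hr : r % 2 = 0) (hs : s % 2 = 0) :
    deletePthPowers 2 (∏ l, X l ^ (![2, 0, p, q] : Fin 4 → ℕ) l * (1 + X l) ^ (![0, 1, r, s] : Fin 4 → ℕ) l : MvPolynomial (Fin 4) (ZMod 2)) = (∏ l, X l ^ (![2, 1, p, q] : Fin 4 → ℕ) l * (1 + X l) ^ (![0, 0, r, s] : Fin 4 → ℕ) l : MvPolynomial (Fin 4) (ZMod 2)) := by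
  have hI := prod_update_e_succ (![2, 0, p, q] : Fin 4 → ℕ) (![0, 0, r, s] : Fin 4 → ℕ) 1
  have h1 : (Function.update (![0, 0, r, s] : Fin 4 → ℕ) 1 ((![0, 0, r, s] : Fin 4 → ℕ) 1 + 1)) = ![0, 1, r, s] := by
    funext l; fin_cases l <;> simp
  have h2 : (Function.update (![2, 0, p, q] : Fin 4 → ℕ) 1 ((![2, 0, p, q] : Fin 4 → ℕ) 1 + 1)) = ![2, 1, p, q] := by
    funext l; fin_cases l <;> simp
  rw [h1, h2] at hI
  rw [hI, deletePthPowers_add, deletePthPowers_prod_of_forall_even _ _ (by intro l; fin_cases l <;> simp <;> omega)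
    (by intro l; fin_cases l <;> simp <;> omega), zero_add,
    deletePthPowers_prod_of_purelyOdd _ _ (l := 1) (by simp) (by simp)]

/-- `(1+x₀)²(1+x₁)·S²` cleans to `(1+x₀)²x₁·S²`. [folklore] -/
theorem clean_flip1_dsq0 (p q r s : ℕ) (hp : p % 2 = 0) (hq : q % 2 = 0) (hr : r % 2 = 0) (hs : s % 2 = 0) :
    deletePthPowers 2 (∏ l, X l ^ (![0, 0, p, q] : Fin 4 → ℕ) l * (1 + X l) ^ (![2, 1, r, s] : Fin 4 → ℕ) l : MvPolynomial (Fin 4) (ZMod 2)) = (∏ l, X l ^ (![0, 1, p, q] : Fin 4 → ℕ) l * (1 + X l) ^ (![2, 0, r, s] : Fin 4 → ℕ) l : MvPolynomial (Fin 4) (ZMod 2)) := by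
  have hI := prod_update_e_succ (![0, 0, p, q] : Fin 4 → ℕ) (![2, 0, r, s] : Fin 4 → ℕ) 1
  have h1 : (Function.update (![2, 0, r, s] : Fin 4 → ℕ) 1 ((![2, 0, r, s] : Fin 4 → ℕ) 1 + 1)) = ![2, 1, r, s] := by
    funext l; fin_cases l <;> simp
  have h2 : (Function.update (![0, 0, p, q] : Fin 4 → ℕ) 1 ((![0, 0, p, q] : Fin 4 → ℕ) 1 + 1)) = ![0, 1, p, q] := by
    funext l; fin_cases l <;> simp
  rw [h1, h2] at hI
  rw [hI, deletePthPowers_add, deletePthPowers_prod_of_forall_even _ _ (by intro l; fin_cases l <;> simp <;> omega)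
    (by intro l; fin_cases l <;> simp <;> omega), zero_add,
    deletePthPowers_prod_of_purelyOdd _ _ (l := 1) (by simp) (by simp)]

/-- `(1+x₀)²x₁·S² = x₁·S² + x₀²x₁·S²` (characteristic `2`). [folklore] -/
theorem split_dsq0 (p q r s : ℕ) :
    (∏ l, X l ^ (![0, 1, p, q] : Fin 4 → ℕ) l * (1 + X l) ^ (![2, 0, r, s] : Fin 4 → ℕ) l : MvPolynomial (Fin 4) (ZMod 2)) = (∏ l, X l ^ (![0, 1, p, q] : Fin 4 → ℕ) l * (1 + X l) ^ (![0, 0, r, s] : Fin 4 → ℕ) l : MvPolynomial (Fin 4) (ZMod 2)) + (∏ l, X l ^ (![2, 1, p, q] : Fin 4 → ℕ) l * (1 + X l) ^ (![0, 0, r, s] : Fin 4 → ℕ) l : MvPolynomial (Fin 4) (ZMod 2)) := by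
  have hI := prod_update_e_add_two (![0, 1, p, q] : Fin 4 → ℕ) (![0, 0, r, s] : Fin 4 → ℕ) 0
  have h1 : (Function.update (![0, 0, r, s] : Fin 4 → ℕ) 0 ((![0, 0, r, s] : Fin 4 → ℕ) 0 + 2)) = ![2, 0, r, s] := by
    funext l; fin_cases l <;> simp
  have h2 : (Function.update (![0, 1, p, q] : Fin 4 → ℕ) 0 ((![0, 1, p, q] : Fin 4 → ℕ) 0 + 2)) = ![2, 1, p, q] := by
    funext l; fin_cases l <;> simp
  rw [h1, h2] at hI
  exact hI

end PureLeafNF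

end Summit.ResolutionOfSingularities.ResolutionOfSingularities.Theorems.PIDim4

end
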